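import Summits.CriticalPhenomena.PercolationContinuityZ3.Theorems.PercNearOneGluingNoHeavyQuantTwoPointPairRouteHigherD
import HarnessLib

/-!
# QUANT lane / PAPER-2 rate track (ARM-2, gen 10): THE PAIR-ROUTE ROWS IN NUMERALS, part 2 — `d = 5` and `d = 6`

builds on p205010 (kernel theorem, internal audit signed; external expert review pending)

Cell `prim-quant`, seat `prim-quant-arm-2` (constants bookkeeper), memo `RATE-CONSTANTS.md` §5.7.  Continuation of
`…QuantTwoPointPairRouteHigherD.lean` (which has `κ_4, κ_5, κ_6`, the root / final-constant lemmas and the `d = 4` rows); same three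
routes (gen 9's generic theorems), registry rows `OneArmPolyDecayAtCritical d c C′` with `b′ = min(b,1)`, `a′ = min(a,1)`:

  | d | pointwise `τ ≤ C‖x‖^{−b}`: c, C′ | X_A, bootstrap pair: c, C′ | X_A, φ-pair: c, C′ |
  |---|---|---|---|
  | 5 | b′/64, 2^845 + 3√C | a′/226, 2^227 + 3√C | a′/208, 2^1372 + 2√C |
  | 6 | b′/76, 2^1641 + 3√C | a′/318, 2^371 + 3√C | a′/296, 2^2609 + 2√C |

(`K_5 ≤ 2^844`: prefactor `≤ 2^53`, `53 + 2478 ≤ 3·844`; `K_6 ≤ 2^1640`: `2^61`, `61 + 4858 ≤ 3·1640`; `K′_5 ≤ 2^226`: `2^233`,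
`233 + 2478 ≤ 12·226`; `K′_6 ≤ 2^370`: `2^316`, `316 + 4858 ≤ 14·370`; `√K″_5 ≤ 2^1371`: `2^264`, `264 + 2478 = 2·1371`;
`√K″_6 ≤ 2^2608`: `2^357`, `357 + 4858 ≤ 2·2608`; `κ_5 ≤ 2^2478`, `κ_6 ≤ 2^4858`.)  Second derivation (exact rationals):
`run/shared/lean/prim/quant/prim-quant-arm-2-g10/code/higher_d.py`.
HONEST FRAMING: implications from OPEN inputs (pointwise two-point decay / X_A at `p_c(ℤ^d)`, open in print for `3 ≤ d ≤ 6`); the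
unconditional rate (class log*) and the honest sentence are UNCHANGED.
[cite: Cerf2015, Prop. 5.2, Lemma 7.1 and §10] [cite: DuminilcopinKozmaTassion2020, §7 (38)–(40)] [cite: DuminilCopinTassionEM2016, Thm. 1.1]
[cite: HeydenreichVanDerHofstad2017, Open Problem 10.1]
-/

noncomputable section

namespace Summit.CriticalPhenomena.PercolationContinuityZ3.Theorems.Quant

open MeasureTheory Literature.Probability.Percolation Literature.Probability.LatticeModels
open Summit.CriticalPhenomena.PercolationContinuityZ3.Theorems.SurfaceTension
open Literature.Probability.Percolation.AKN
open scoped Classical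

/-! ## §3b. `d = 5`: exponents `b′/64`, `a′/226`, `a′/208` -/

/-- `K_5 ≤ 2^844` (`20·(3/2)·5⁴·64·5^{14} ≤ 2^53`, `κ_5 ≤ 2^2478`, `53 + 2478 ≤ 3·844`). [cite: Cerf2015, Prop. 5.2] -/
theorem pairConst_five_le :
    (20 * Real.sqrt 2 * (((5 : ℕ) : ℝ)) ^ 4 * (12 * (((5 : ℕ) : ℝ)) + 4) * 5 ^ (3 * 5 - 1) *
        aknKappa 5 (1 / (2 * (((5 : ℕ) : ℝ))))) ^ (1 / 3 : ℝ) ≤ (2 : ℝ) ^ (844 : ℕ) := by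
  have hδ : (1 / (2 * (((5 : ℕ) : ℝ))) : ℝ) = 1 / 10 := by norm_num
  rw [hδ]
  have hκ0 : 0 ≤ aknKappa 5 (1 / 10) := le_trans (by norm_num) (three_le_aknKappa 5 _)
  have h1 : 20 * Real.sqrt 2 * (((5 : ℕ) : ℝ)) ^ 4 * (12 * (((5 : ℕ) : ℝ)) + 4) * 5 ^ (3 * 5 - 1) * aknKappa 5 (1 / 10)
      = (20 * 5 ^ 4 * 64 * 5 ^ 14) * Real.sqrt 2 * aknKappa 5 (1 / 10) := by
    rw [show 3 * 5 - 1 = 14 by norm_num]; push_cast; ring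
  rw [h1, show (1 / 3 : ℝ) = 1 / ((3 : ℕ) : ℝ) by norm_num]
  refine rpow_one_div_le_two_pow (by norm_num) (mul_nonneg (by positivity) hκ0) ?_
  exact prod_sqrt_two_kappa_le (a := 53) (kb := 2478) (by norm_num) (by norm_num) hκ0 aknKappa_five_tenth_le |>.trans (pow_le_pow_right₀ (by norm_num) (by norm_num))

/-- **POINTWISE ⟹ (T1) ON `ℤ⁵`, PAIR ROUTE**: `τ_{p_c}(0,x) ≤ C‖x‖^{−b}` (`x ≠ 0`, `b > 0`) ⟹
`OneArmPolyDecayAtCritical 5 (min(b,1)/64) (2^845 + 3√C)`.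
builds on p205010 (kernel theorem, internal audit signed; external expert review pending).
[cite: Cerf2015, Prop. 5.2, Lemma 7.1 and §10] [cite: DuminilcopinKozmaTassion2020, §7 (38)–(39)] [cite: HeydenreichVanDerHofstad2017, Open Problem 10.1] -/
theorem oneArmPolyDecayAtCritical_Z5_of_pointwiseTwoPoint_pair {b C : ℝ} (hb0 : 0 < b)
    (hτ : ∀ x : Site 5, x ≠ 0 → tau 5 (criticalProbI 5) 0 x ≤ C * ‖x‖ ^ (-b)) :
    OneArmPolyDecayAtCritical 5 (min b 1 / 64) ((2 : ℝ) ^ (845 : ℕ) + 3 * Real.sqrt C) := by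
  have h := oneArmPolyDecayAtCritical_of_pointwiseTwoPoint_pair (d := 5) (by norm_num) hb0 hτ
  have hexp : min b 1 / (12 * (((5 : ℕ) : ℝ)) + 4) = min b 1 / 64 := by norm_num
  rw [hexp] at h
  refine oneArmPolyDecayAtCritical_const_mono h ?_
  have hc0 : 0 ≤ min b 1 / 64 := by have := lt_min hb0 one_pos; positivity
  have hc1 : min b 1 / 64 ≤ 1 / 40 := by have := min_le_right b 1; linarith
  exact final_const_add_le hc0 hc1
    (Real.rpow_nonneg (mul_nonneg (by positivity) (le_trans (by norm_num) (three_le_aknKappa 5 _))) _) pairConst_five_le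

/-- **THE PRINTED CONDITIONAL POWER LAW ON `ℤ⁵`, PAIR ROUTE**: IF `P_{p_c}(0 ↔ x) ≤ C‖x‖_∞^{−b}` for all `x ≠ 0` (`b > 0`), THEN
**`π_{p_c(ℤ⁵)}(n) ≤ (2^845 + 3√C) · n^{−min(b,1)/64}`** for every `n ≥ 1`.
builds on p205010 (kernel theorem, internal audit signed; external expert review pending).
[cite: Cerf2015, Prop. 5.2, Lemma 7.1 and §10] [cite: DuminilcopinKozmaTassion2020, §7 (38)–(39)] [cite: HeydenreichVanDerHofstad2017, Open Problem 10.1] -/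
theorem oneArm_powerLaw_Z5_of_pointwiseTwoPoint_pair {b C : ℝ} (hb0 : 0 < b)
    (hτ : ∀ x : Site 5, x ≠ 0 → (bondPercolation (zdGraph 5) (criticalProbI 5)).real (openConn 0 x) ≤ C * ‖x‖ ^ (-b)) :
    ∀ n : ℕ, 1 ≤ n → oneArmProb 5 (criticalProbI 5) n ≤ ((2 : ℝ) ^ (845 : ℕ) + 3 * Real.sqrt C) * (n : ℝ) ^ (-(min b 1 / 64)) :=
  fun n hn => oneArmPolyDecayAtCritical_Z5_of_pointwiseTwoPoint_pair hb0 hτ n hn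

/-- `K′_5 ≤ 2^226` (`10·(3/2)·125·10^{22}·226·7^{50} ≤ 2^233`, `233 + 2478 ≤ 12·226`). [cite: Cerf2015, Prop. 5.2] -/
theorem pairConstBall_five_le :
    (10 * Real.sqrt 2 * (((5 : ℕ) : ℝ)) ^ 3 * (2 * (((5 : ℕ) : ℝ))) ^ (4 * 5 + 2) * (8 * (((5 : ℕ) : ℝ)) ^ 2 + 4 * ((5 : ℕ) : ℝ) + 6) *
        7 ^ (2 * 5 ^ 2) * aknKappa 5 (1 / (2 * (((5 : ℕ) : ℝ))))) ^ (1 / (2 * (((5 : ℕ) : ℝ)) + 2)) ≤ (2 : ℝ) ^ (226 : ℕ) := by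
  have hδ : (1 / (2 * (((5 : ℕ) : ℝ))) : ℝ) = 1 / 10 := by norm_num
  have hex : (1 / (2 * (((5 : ℕ) : ℝ)) + 2) : ℝ) = 1 / ((12 : ℕ) : ℝ) := by norm_num
  rw [hδ, hex]
  have hκ0 : 0 ≤ aknKappa 5 (1 / 10) := le_trans (by norm_num) (three_le_aknKappa 5 _)
  have h1 : 10 * Real.sqrt 2 * (((5 : ℕ) : ℝ)) ^ 3 * (2 * (((5 : ℕ) : ℝ))) ^ (4 * 5 + 2) *
        (8 * (((5 : ℕ) : ℝ)) ^ 2 + 4 * ((5 : ℕ) : ℝ) + 6) * 7 ^ (2 * 5 ^ 2) * aknKappa 5 (1 / 10)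
      = (10 * 5 ^ 3 * 10 ^ 22 * 226 * 7 ^ 50) * Real.sqrt 2 * aknKappa 5 (1 / 10) := by
    rw [show 4 * 5 + 2 = 22 by norm_num, show 2 * 5 ^ 2 = 50 by norm_num]; push_cast; ring
  rw [h1]
  refine rpow_one_div_le_two_pow (by norm_num) (mul_nonneg (by positivity) hκ0) ?_
  exact prod_sqrt_two_kappa_le (a := 233) (kb := 2478) (by norm_num) (by norm_num) hκ0 aknKappa_five_tenth_le |>.trans (pow_le_pow_right₀ (by norm_num) (by norm_num))

/-- **X_A ⟹ (T1) ON `ℤ⁵`, PAIR ROUTE (bootstrap)**: `Σ_{x ∈ Λ_R} τ_{p_c}(0,x) ≤ C R^{5−a}` for all `R ≥ 1` (`a > 0`) ⟹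
`OneArmPolyDecayAtCritical 5 (min(a,1)/226) (2^227 + 3√C)`.
builds on p205010 (kernel theorem, internal audit signed; external expert review pending).
[cite: Cerf2015, Lemma 7.1 and §10] [cite: DuminilcopinKozmaTassion2020, §7 (38)–(40)] [cite: HeydenreichVanDerHofstad2017, Open Problem 10.1] -/
theorem oneArmPolyDecayAtCritical_Z5_of_ballTwoPoint_pair {a C : ℝ} (ha0 : 0 < a)
    (hS : ∀ R : ℕ, 1 ≤ R → ∑ x ∈ box 5 R, tau 5 (criticalProbI 5) 0 x ≤ C * (R : ℝ) ^ ((5 : ℝ) - a)) :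
    OneArmPolyDecayAtCritical 5 (min a 1 / 226) ((2 : ℝ) ^ (227 : ℕ) + 3 * Real.sqrt C) := by
  have hS' : ∀ R : ℕ, 1 ≤ R → ∑ x ∈ box 5 R, tau 5 (criticalProbI 5) 0 x ≤ C * (R : ℝ) ^ ((((5 : ℕ) : ℝ)) - a) := by
    intro R hR; rw [show (((5 : ℕ) : ℝ)) = (5 : ℝ) by norm_num]; exact hS R hR
  have h := oneArmPolyDecayAtCritical_of_ballTwoPoint_pair (d := 5) (by norm_num) ha0 hS'
  have hexp : min a 1 / (8 * (((5 : ℕ) : ℝ)) ^ 2 + 4 * ((5 : ℕ) : ℝ) + 6) = min a 1 / 226 := by norm_num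
  rw [hexp] at h
  refine oneArmPolyDecayAtCritical_const_mono h ?_
  have hc0 : 0 ≤ min a 1 / 226 := by have := lt_min ha0 one_pos; positivity
  have hc1 : min a 1 / 226 ≤ 1 / 40 := by have := min_le_right a 1; linarith
  exact final_const_add_le hc0 hc1
    (Real.rpow_nonneg (mul_nonneg (by positivity) (le_trans (by norm_num) (three_le_aknKappa 5 _))) _) pairConstBall_five_le

set_option exponentiation.threshold 400 in
/-- `K″_5 ≤ 2^{2742}` (`5·(3/2)·125·10^{32}·104·7^{50} ≤ 2^264`, `264 + 2478 ≤ 2742`). [cite: Cerf2015, Prop. 5.2] -/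
theorem pairConstCrit_five_le :
    5 * Real.sqrt 2 * (((5 : ℕ) : ℝ)) ^ 3 * (2 * (((5 : ℕ) : ℝ))) ^ (6 * 5 + 2) * (4 * (((5 : ℕ) : ℝ)) ^ 2 + 4) * 7 ^ (2 * 5 ^ 2) *
        aknKappa 5 (1 / (2 * (((5 : ℕ) : ℝ)))) ≤ (2 : ℝ) ^ (2 * 1371) := by
  have hδ : (1 / (2 * (((5 : ℕ) : ℝ))) : ℝ) = 1 / 10 := by norm_num
  rw [hδ]
  have hκ0 : 0 ≤ aknKappa 5 (1 / 10) := le_trans (by norm_num) (three_le_aknKappa 5 _)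
  have h1 : 5 * Real.sqrt 2 * (((5 : ℕ) : ℝ)) ^ 3 * (2 * (((5 : ℕ) : ℝ))) ^ (6 * 5 + 2) * (4 * (((5 : ℕ) : ℝ)) ^ 2 + 4) * 7 ^ (2 * 5 ^ 2) *
        aknKappa 5 (1 / 10) = (5 * 5 ^ 3 * 10 ^ 32 * 104 * 7 ^ 50) * Real.sqrt 2 * aknKappa 5 (1 / 10) := by
    rw [show 6 * 5 + 2 = 32 by norm_num, show 2 * 5 ^ 2 = 50 by norm_num]; push_cast; ring
  rw [h1]
  exact prod_sqrt_two_kappa_le (a := 264) (kb := 2478) (by norm_num) (by norm_num) hκ0 aknKappa_five_tenth_le |>.trans (pow_le_pow_right₀ (by norm_num) (by norm_num))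

/-- **X_A ⟹ (T1) ON `ℤ⁵`, `φ`-PAIR ROUTE**: `Σ_{x ∈ Λ_R} τ_{p_c}(0,x) ≤ C R^{5−a}` for all `R ≥ 1` (`a > 0`) ⟹
`OneArmPolyDecayAtCritical 5 (min(a,1)/208) (2^1372 + 2√C)` — the best conditional exponent for X_A on `ℤ⁵` in the tree.
builds on p205010 (kernel theorem, internal audit signed; external expert review pending).
[cite: Cerf2015, Lemma 6.1, Lemma 7.1 and §10] [cite: DuminilCopinTassionEM2016, Thm. 1.1] [cite: HeydenreichVanDerHofstad2017, Open Problem 10.1] -/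
theorem oneArmPolyDecayAtCritical_Z5_of_ballTwoPoint_pair_crit {a C : ℝ} (ha0 : 0 < a)
    (hS : ∀ R : ℕ, 1 ≤ R → ∑ x ∈ box 5 R, tau 5 (criticalProbI 5) 0 x ≤ C * (R : ℝ) ^ ((5 : ℝ) - a)) :
    OneArmPolyDecayAtCritical 5 (min a 1 / 208) ((2 : ℝ) ^ (1372 : ℕ) + 2 * Real.sqrt C) := by
  have hS' : ∀ R : ℕ, 1 ≤ R → ∑ x ∈ box 5 R, tau 5 (criticalProbI 5) 0 x ≤ C * (R : ℝ) ^ ((((5 : ℕ) : ℝ)) - a) := by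
    intro R hR; rw [show (((5 : ℕ) : ℝ)) = (5 : ℝ) by norm_num]; exact hS R hR
  have hC1 : 1 ≤ C := one_le_const_of_ballTwoPoint (criticalProbI 5) hS'
  have h := oneArmPolyDecayAtCritical_of_ballTwoPoint_pair_crit (d := 5) (by norm_num) ha0 hS'
  have hexp : min a 1 / (8 * (((5 : ℕ) : ℝ)) ^ 2 + 8) = min a 1 / 208 := by norm_num
  rw [hexp] at h
  refine oneArmPolyDecayAtCritical_const_mono h ?_
  have hc0 : 0 ≤ min a 1 / 208 := by have := lt_min ha0 one_pos; positivity
  have hc1 : min a 1 / 208 ≤ 1 / 40 := by have := min_le_right a 1; linarith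
  exact final_const_sqrt_le hc0 hc1 (by linarith)
    (mul_nonneg (by positivity) (le_trans (by norm_num) (three_le_aknKappa 5 _))) pairConstCrit_five_le

/-! ## §3c. `d = 6`: exponents `b′/76`, `a′/318`, `a′/296` -/

/-- `K_6 ≤ 2^1640` (`20·(3/2)·6⁴·76·5^{17} ≤ 2^61`, `κ_6 ≤ 2^4858`, `61 + 4858 ≤ 3·1640`). [cite: Cerf2015, Prop. 5.2] -/
theorem pairConst_six_le :
    (20 * Real.sqrt 2 * (((6 : ℕ) : ℝ)) ^ 4 * (12 * (((6 : ℕ) : ℝ)) + 4) * 5 ^ (3 * 6 - 1) *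
        aknKappa 6 (1 / (2 * (((6 : ℕ) : ℝ))))) ^ (1 / 3 : ℝ) ≤ (2 : ℝ) ^ (1640 : ℕ) := by
  have hδ : (1 / (2 * (((6 : ℕ) : ℝ))) : ℝ) = 1 / 12 := by norm_num
  rw [hδ]
  have hκ0 : 0 ≤ aknKappa 6 (1 / 12) := le_trans (by norm_num) (three_le_aknKappa 6 _)
  have h1 : 20 * Real.sqrt 2 * (((6 : ℕ) : ℝ)) ^ 4 * (12 * (((6 : ℕ) : ℝ)) + 4) * 5 ^ (3 * 6 - 1) * aknKappa 6 (1 / 12)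
      = (20 * 6 ^ 4 * 76 * 5 ^ 17) * Real.sqrt 2 * aknKappa 6 (1 / 12) := by
    rw [show 3 * 6 - 1 = 17 by norm_num]; push_cast; ring
  rw [h1, show (1 / 3 : ℝ) = 1 / ((3 : ℕ) : ℝ) by norm_num]
  refine rpow_one_div_le_two_pow (by norm_num) (mul_nonneg (by positivity) hκ0) ?_
  exact prod_sqrt_two_kappa_le (a := 61) (kb := 4858) (by norm_num) (by norm_num) hκ0 aknKappa_six_twelfth_le |>.trans (pow_le_pow_right₀ (by norm_num) (by norm_num))

/-- **POINTWISE ⟹ (T1) ON `ℤ⁶`, PAIR ROUTE**: `τ_{p_c}(0,x) ≤ C‖x‖^{−b}` (`x ≠ 0`, `b > 0`) ⟹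
`OneArmPolyDecayAtCritical 6 (min(b,1)/76) (2^1641 + 3√C)`.
builds on p205010 (kernel theorem, internal audit signed; external expert review pending).
[cite: Cerf2015, Prop. 5.2, Lemma 7.1 and §10] [cite: DuminilcopinKozmaTassion2020, §7 (38)–(39)] [cite: HeydenreichVanDerHofstad2017, Open Problem 10.1] -/
theorem oneArmPolyDecayAtCritical_Z6_of_pointwiseTwoPoint_pair {b C : ℝ} (hb0 : 0 < b)
    (hτ : ∀ x : Site 6, x ≠ 0 → tau 6 (criticalProbI 6) 0 x ≤ C * ‖x‖ ^ (-b)) :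
    OneArmPolyDecayAtCritical 6 (min b 1 / 76) ((2 : ℝ) ^ (1641 : ℕ) + 3 * Real.sqrt C) := by
  have h := oneArmPolyDecayAtCritical_of_pointwiseTwoPoint_pair (d := 6) (by norm_num) hb0 hτ
  have hexp : min b 1 / (12 * (((6 : ℕ) : ℝ)) + 4) = min b 1 / 76 := by norm_num
  rw [hexp] at h
  refine oneArmPolyDecayAtCritical_const_mono h ?_
  have hc0 : 0 ≤ min b 1 / 76 := by have := lt_min hb0 one_pos; positivity
  have hc1 : min b 1 / 76 ≤ 1 / 40 := by have := min_le_right b 1; linarith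
  exact final_const_add_le hc0 hc1
    (Real.rpow_nonneg (mul_nonneg (by positivity) (le_trans (by norm_num) (three_le_aknKappa 6 _))) _) pairConst_six_le

/-- **THE PRINTED CONDITIONAL POWER LAW ON `ℤ⁶`, PAIR ROUTE**: IF `P_{p_c}(0 ↔ x) ≤ C‖x‖_∞^{−b}` for all `x ≠ 0` (`b > 0`), THEN
**`π_{p_c(ℤ⁶)}(n) ≤ (2^1641 + 3√C) · n^{−min(b,1)/76}`** for every `n ≥ 1`.
builds on p205010 (kernel theorem, internal audit signed; external expert review pending).
[cite: Cerf2015, Prop. 5.2, Lemma 7.1 and §10] [cite: DuminilcopinKozmaTassion2020, §7 (38)–(39)] [cite: HeydenreichVanDerHofstad2017, Open Problem 10.1] -/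
theorem oneArm_powerLaw_Z6_of_pointwiseTwoPoint_pair {b C : ℝ} (hb0 : 0 < b)
    (hτ : ∀ x : Site 6, x ≠ 0 → (bondPercolation (zdGraph 6) (criticalProbI 6)).real (openConn 0 x) ≤ C * ‖x‖ ^ (-b)) :
    ∀ n : ℕ, 1 ≤ n → oneArmProb 6 (criticalProbI 6) n ≤ ((2 : ℝ) ^ (1641 : ℕ) + 3 * Real.sqrt C) * (n : ℝ) ^ (-(min b 1 / 76)) :=
  fun n hn => oneArmPolyDecayAtCritical_Z6_of_pointwiseTwoPoint_pair hb0 hτ n hn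

set_option exponentiation.threshold 400 in
/-- `K′_6 ≤ 2^370` (`10·(3/2)·216·12^{26}·318·7^{72} ≤ 2^316`, `316 + 4858 ≤ 14·370`). [cite: Cerf2015, Prop. 5.2] -/
theorem pairConstBall_six_le :
    (10 * Real.sqrt 2 * (((6 : ℕ) : ℝ)) ^ 3 * (2 * (((6 : ℕ) : ℝ))) ^ (4 * 6 + 2) * (8 * (((6 : ℕ) : ℝ)) ^ 2 + 4 * ((6 : ℕ) : ℝ) + 6) *
        7 ^ (2 * 6 ^ 2) * aknKappa 6 (1 / (2 * (((6 : ℕ) : ℝ))))) ^ (1 / (2 * (((6 : ℕ) : ℝ)) + 2)) ≤ (2 : ℝ) ^ (370 : ℕ) := by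
  have hδ : (1 / (2 * (((6 : ℕ) : ℝ))) : ℝ) = 1 / 12 := by norm_num
  have hex : (1 / (2 * (((6 : ℕ) : ℝ)) + 2) : ℝ) = 1 / ((14 : ℕ) : ℝ) := by norm_num
  rw [hδ, hex]
  have hκ0 : 0 ≤ aknKappa 6 (1 / 12) := le_trans (by norm_num) (three_le_aknKappa 6 _)
  have h1 : 10 * Real.sqrt 2 * (((6 : ℕ) : ℝ)) ^ 3 * (2 * (((6 : ℕ) : ℝ))) ^ (4 * 6 + 2) *
        (8 * (((6 : ℕ) : ℝ)) ^ 2 + 4 * ((6 : ℕ) : ℝ) + 6) * 7 ^ (2 * 6 ^ 2) * aknKappa 6 (1 / 12)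
      = (10 * 6 ^ 3 * 12 ^ 26 * 318 * 7 ^ 72) * Real.sqrt 2 * aknKappa 6 (1 / 12) := by
    rw [show 4 * 6 + 2 = 26 by norm_num, show 2 * 6 ^ 2 = 72 by norm_num]; push_cast; ring
  rw [h1]
  refine rpow_one_div_le_two_pow (by norm_num) (mul_nonneg (by positivity) hκ0) ?_
  exact prod_sqrt_two_kappa_le (a := 316) (kb := 4858) (by norm_num) (by norm_num) hκ0 aknKappa_six_twelfth_le |>.trans (pow_le_pow_right₀ (by norm_num) (by norm_num))

/-- **X_A ⟹ (T1) ON `ℤ⁶`, PAIR ROUTE (bootstrap)**: `Σ_{x ∈ Λ_R} τ_{p_c}(0,x) ≤ C R^{6−a}` for all `R ≥ 1` (`a > 0`) ⟹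
`OneArmPolyDecayAtCritical 6 (min(a,1)/318) (2^371 + 3√C)`.
builds on p205010 (kernel theorem, internal audit signed; external expert review pending).
[cite: Cerf2015, Lemma 7.1 and §10] [cite: DuminilcopinKozmaTassion2020, §7 (38)–(40)] [cite: HeydenreichVanDerHofstad2017, Open Problem 10.1] -/
theorem oneArmPolyDecayAtCritical_Z6_of_ballTwoPoint_pair {a C : ℝ} (ha0 : 0 < a)
    (hS : ∀ R : ℕ, 1 ≤ R → ∑ x ∈ box 6 R, tau 6 (criticalProbI 6) 0 x ≤ C * (R : ℝ) ^ ((6 : ℝ) - a)) :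
    OneArmPolyDecayAtCritical 6 (min a 1 / 318) ((2 : ℝ) ^ (371 : ℕ) + 3 * Real.sqrt C) := by
  have hS' : ∀ R : ℕ, 1 ≤ R → ∑ x ∈ box 6 R, tau 6 (criticalProbI 6) 0 x ≤ C * (R : ℝ) ^ ((((6 : ℕ) : ℝ)) - a) := by
    intro R hR; rw [show (((6 : ℕ) : ℝ)) = (6 : ℝ) by norm_num]; exact hS R hR
  have h := oneArmPolyDecayAtCritical_of_ballTwoPoint_pair (d := 6) (by norm_num) ha0 hS'
  have hexp : min a 1 / (8 * (((6 : ℕ) : ℝ)) ^ 2 + 4 * ((6 : ℕ) : ℝ) + 6) = min a 1 / 318 := by norm_num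
  rw [hexp] at h
  refine oneArmPolyDecayAtCritical_const_mono h ?_
  have hc0 : 0 ≤ min a 1 / 318 := by have := lt_min ha0 one_pos; positivity
  have hc1 : min a 1 / 318 ≤ 1 / 40 := by have := min_le_right a 1; linarith
  exact final_const_add_le hc0 hc1
    (Real.rpow_nonneg (mul_nonneg (by positivity) (le_trans (by norm_num) (three_le_aknKappa 6 _))) _) pairConstBall_six_le

set_option exponentiation.threshold 400 in
/-- `K″_6 ≤ 2^{5216}` (`5·(3/2)·216·12^{38}·148·7^{72} ≤ 2^357`, `357 + 4858 ≤ 5216`). [cite: Cerf2015, Prop. 5.2] -/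
theorem pairConstCrit_six_le :
    5 * Real.sqrt 2 * (((6 : ℕ) : ℝ)) ^ 3 * (2 * (((6 : ℕ) : ℝ))) ^ (6 * 6 + 2) * (4 * (((6 : ℕ) : ℝ)) ^ 2 + 4) * 7 ^ (2 * 6 ^ 2) *
        aknKappa 6 (1 / (2 * (((6 : ℕ) : ℝ)))) ≤ (2 : ℝ) ^ (2 * 2608) := by
  have hδ : (1 / (2 * (((6 : ℕ) : ℝ))) : ℝ) = 1 / 12 := by norm_num
  rw [hδ]
  have hκ0 : 0 ≤ aknKappa 6 (1 / 12) := le_trans (by norm_num) (three_le_aknKappa 6 _)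
  have h1 : 5 * Real.sqrt 2 * (((6 : ℕ) : ℝ)) ^ 3 * (2 * (((6 : ℕ) : ℝ))) ^ (6 * 6 + 2) * (4 * (((6 : ℕ) : ℝ)) ^ 2 + 4) * 7 ^ (2 * 6 ^ 2) *
        aknKappa 6 (1 / 12) = (5 * 6 ^ 3 * 12 ^ 38 * 148 * 7 ^ 72) * Real.sqrt 2 * aknKappa 6 (1 / 12) := by
    rw [show 6 * 6 + 2 = 38 by norm_num, show 2 * 6 ^ 2 = 72 by norm_num]; push_cast; ring
  rw [h1]
  exact prod_sqrt_two_kappa_le (a := 357) (kb := 4858) (by norm_num) (by norm_num) hκ0 aknKappa_six_twelfth_le |>.trans (pow_le_pow_right₀ (by norm_num) (by norm_num))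

/-- **X_A ⟹ (T1) ON `ℤ⁶`, `φ`-PAIR ROUTE**: `Σ_{x ∈ Λ_R} τ_{p_c}(0,x) ≤ C R^{6−a}` for all `R ≥ 1` (`a > 0`) ⟹
`OneArmPolyDecayAtCritical 6 (min(a,1)/296) (2^2609 + 2√C)` — the best conditional exponent for X_A on `ℤ⁶` in the tree.
builds on p205010 (kernel theorem, internal audit signed; external expert review pending).
[cite: Cerf2015, Lemma 6.1, Lemma 7.1 and §10] [cite: DuminilCopinTassionEM2016, Thm. 1.1] [cite: HeydenreichVanDerHofstad2017, Open Problem 10.1] -/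
theorem oneArmPolyDecayAtCritical_Z6_of_ballTwoPoint_pair_crit {a C : ℝ} (ha0 : 0 < a)
    (hS : ∀ R : ℕ, 1 ≤ R → ∑ x ∈ box 6 R, tau 6 (criticalProbI 6) 0 x ≤ C * (R : ℝ) ^ ((6 : ℝ) - a)) :
    OneArmPolyDecayAtCritical 6 (min a 1 / 296) ((2 : ℝ) ^ (2609 : ℕ) + 2 * Real.sqrt C) := by
  have hS' : ∀ R : ℕ, 1 ≤ R → ∑ x ∈ box 6 R, tau 6 (criticalProbI 6) 0 x ≤ C * (R : ℝ) ^ ((((6 : ℕ) : ℝ)) - a) := by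
    intro R hR; rw [show (((6 : ℕ) : ℝ)) = (6 : ℝ) by norm_num]; exact hS R hR
  have hC1 : 1 ≤ C := one_le_const_of_ballTwoPoint (criticalProbI 6) hS'
  have h := oneArmPolyDecayAtCritical_of_ballTwoPoint_pair_crit (d := 6) (by norm_num) ha0 hS'
  have hexp : min a 1 / (8 * (((6 : ℕ) : ℝ)) ^ 2 + 8) = min a 1 / 296 := by norm_num
  rw [hexp] at h
  refine oneArmPolyDecayAtCritical_const_mono h ?_
  have hc0 : 0 ≤ min a 1 / 296 := by have := lt_min ha0 one_pos; positivity
  have hc1 : min a 1 / 296 ≤ 1 / 40 := by have := min_le_right a 1; linarith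
  exact final_const_sqrt_le hc0 hc1 (by linarith)
    (mul_nonneg (by positivity) (le_trans (by norm_num) (three_le_aknKappa 6 _))) pairConstCrit_six_le

end Summit.CriticalPhenomena.PercolationContinuityZ3.Theorems.Quant

end
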